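import Summits.QuantumFields.YangMills.Theorems.LuscherReductionOneSiteLevelsKacClass

/-!
# INNER, flat lane (layer III): Green's identity and polarisation on the admissible class

Support module of crux `OneSiteLevels` (route `LuscherReduction`, item stmt-QuantumFields-20007), FLAT lane of the
registered v12 stub `stub_flatKacAL1` (STUB-PLAN rev 3 rows G1–G4).  Over the class `IsKacFn` of `…KacClass.lean`:

* §1 the bilinear energy `energyBil u v = ∫ ½ Σ_p ∂_p u ∂_p v + V u v`, `energyBil u u = energyForm u`, polarisation
  `energyForm (u + v) = energyForm u + 2 energyBil u v + energyForm v`, and GREEN'S IDENTITY on the class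
  `energyBil u v = ∫ u · hApply v` (one whole-space integration by parts per coordinate, Mathlib
  `integral_mul_fderiv_eq_neg_fderiv_mul_of_integrable`; no cut-off, no limit).
* §2 consequences for an AL1 eigenfamily: `energyBil u f_j = E_j ⟨u, f_j⟩`, `energyForm (Σ c_j f_j) = Σ c_j² E_j`,
  `energyForm (u + Σ c_j f_j) = energyForm u + Σ c_j² E_j` when `u ⊥ f_j`.

Real analysis only ([folklore]); NOT the stub; femto rung R2b1; NOT a claim about the gap.
References: S. Agmon, Lectures on exponential decay (1982) (1.16); M. Reed, B. Simon IV, Thm. XIII.1–2, XIII.64.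
-/

set_option autoImplicit false

noncomputable section

open MeasureTheory Filter Topology Real
open Literature.Analysis.OperatorTheory.YMMatrixModel

namespace Summit.QuantumFields.YangMills.Theorems.FemtoTransferGap

/-! ### §1. The bilinear energy, polarisation, and Green's identity -/

/-- The bilinear energy form `𝔮(u,v) = ∫ ½ Σ_p ∂_p u ∂_p v + V u v` (polarisation of `energyForm`). [folklore] -/
def energyBil (u v : ZM → ℝ) : ℝ :=
  ∫ x, ((1 / 2 : ℝ) * (∑ p, pderiv p u x * pderiv p v x) + luscherPotential x * (u x * v x))

/-- `𝔮(u,u) = 𝔮(u)`. [cite: ReedSimonIV1978, Thm. XIII.2] -/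
theorem energyBil_self (u : ZM → ℝ) : energyBil u u = energyForm u := by
  unfold energyBil energyForm
  refine integral_congr_ae (Eventually.of_forall fun x => ?_)
  show (1 / 2 : ℝ) * (∑ p, pderiv p u x * pderiv p u x) + luscherPotential x * (u x * u x) =
    (1 / 2 : ℝ) * ‖gradient u x‖ ^ 2 + luscherPotential x * u x ^ 2
  rw [norm_gradient_sq]
  simp only [sq]

/-- `𝔮(u,v) = 𝔮(v,u)`. [cite: ReedSimonIV1978, Thm. XIII.2] -/
theorem energyBil_comm (u v : ZM → ℝ) : energyBil u v = energyBil v u := by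
  unfold energyBil
  refine integral_congr_ae (Eventually.of_forall fun x => ?_)
  simp only [mul_comm]

section Bilinear

variable {u v w : ZM → ℝ}

/-- The integrand of `energyBil u v` is integrable for members. [folklore] -/
theorem IsKacFn.integrable_energyBil (hu : IsKacFn u) (hv : IsKacFn v) :
    Integrable fun x => (1 / 2 : ℝ) * (∑ p, pderiv p u x * pderiv p v x) + luscherPotential x * (u x * v x) :=
  ((integrable_finsetSum _ fun p _ => hu.integrable_pderiv_mul_pderiv hv p p).const_mul _).add
    (hu.integrable_potential_mul hv)

/-- Additivity in the first slot (members). [folklore] -/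
theorem energyBil_add_left (hu : IsKacFn u) (hv : IsKacFn v) (hw : IsKacFn w) :
    energyBil (u + v) w = energyBil u w + energyBil v w := by
  unfold energyBil
  rw [← integral_add (hu.integrable_energyBil hw) (hv.integrable_energyBil hw)]
  refine integral_congr_ae (Eventually.of_forall fun x => ?_)
  simp only [pderiv_add hu.differentiable hv.differentiable, Pi.add_apply, add_mul, Finset.sum_add_distrib]
  ring

/-- Homogeneity in the first slot. [folklore] -/
theorem energyBil_smul_left (a : ℝ) (u w : ZM → ℝ) : energyBil (a • u) w = a * energyBil u w := by
  unfold energyBil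
  rw [← integral_const_mul]
  refine integral_congr_ae (Eventually.of_forall fun x => ?_)
  simp only [pderiv_smul, Pi.smul_apply, smul_eq_mul]
  have e : ∑ p, a * pderiv p u x * pderiv p w x = a * ∑ p, pderiv p u x * pderiv p w x := by
    rw [Finset.mul_sum]; exact Finset.sum_congr rfl fun p _ => by ring
  rw [e]; ring

/-- **Polarisation**: `𝔮(u + v) = 𝔮(u) + 2𝔮(u,v) + 𝔮(v)` for members. [cite: ReedSimonIV1978, Thm. XIII.2] -/
theorem energyForm_add (hu : IsKacFn u) (hv : IsKacFn v) :
    energyForm (u + v) = energyForm u + 2 * energyBil u v + energyForm v := by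
  rw [← energyBil_self, energyBil_add_left hu hv (hu.add hv), energyBil_comm u (u + v), energyBil_comm v (u + v),
    energyBil_add_left hu hv hu, energyBil_add_left hu hv hv, energyBil_self, energyBil_self, energyBil_comm v u]
  ring

/-- `𝔮(a • u) = a² 𝔮(u)` (any differentiable `u`; restated for members). [folklore] -/
theorem energyForm_smul' (hu : IsKacFn u) (a : ℝ) : energyForm (a • u) = a ^ 2 * energyForm u :=
  energyForm_smul hu.differentiable a

/-- **Green's identity on the admissible class** (no cut-off, no limit): `𝔮(u,v) = ∫ u · 𝔥v` for `u, v ∈ IsKacFn`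
— one whole-space integration by parts per coordinate, `∫ ∂_p u ∂_p v = −∫ u ∂_p∂_p v`. [cite: Agmon1982, (1.16)] -/
theorem energyBil_eq_integral_mul_hApply (hu : IsKacFn u) (hv : IsKacFn v) :
    energyBil u v = ∫ x, u x * hApply v x := by
  -- one coordinate
  have ibp : ∀ p, ∫ x, pderiv p u x * pderiv p v x = -∫ x, u x * pderiv p (pderiv p v) x := by
    intro p
    have h := integral_mul_fderiv_eq_neg_fderiv_mul_of_integrable (μ := volume) (f := u) (g := pderiv p v)
      (v := unitDir p) ?_ ?_ ?_ (fun x _ => hu.differentiable x) (fun x _ => hv.differentiable_pderiv p x)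
    · -- h : ∫ u * ∂_p(∂_p v) = -∫ ∂_p u * ∂_p v
      have e1 : ∫ x, u x * fderiv ℝ (pderiv p v) x (unitDir p) = ∫ x, u x * pderiv p (pderiv p v) x := rfl
      have e2 : ∫ x, fderiv ℝ u x (unitDir p) * pderiv p v x = ∫ x, pderiv p u x * pderiv p v x := rfl
      rw [e1, e2] at h
      linarith
    · exact hu.integrable_pderiv_mul_pderiv hv p p
    · exact hu.integrable_mul_pderiv_pderiv hv p p
    · exact hu.integrable_mul_pderiv hv p
  unfold energyBil
  have I1 : ∀ p, Integrable fun x => pderiv p u x * pderiv p v x := fun p => hu.integrable_pderiv_mul_pderiv hv p p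
  have I2 := hu.integrable_potential_mul hv
  have I3 : ∀ p, Integrable fun x => u x * pderiv p (pderiv p v) x := fun p => hu.integrable_mul_pderiv_pderiv hv p p
  rw [integral_add ((integrable_finsetSum _ fun p _ => I1 p).const_mul _) I2, integral_const_mul,
    integral_finsetSum _ fun p _ => I1 p]
  simp_rw [ibp]
  have eR : ∫ x, u x * hApply v x =
      -(1 / 2 : ℝ) * (∑ p, ∫ x, u x * pderiv p (pderiv p v) x) + ∫ x, luscherPotential x * (u x * v x) := by
    rw [← integral_finsetSum _ fun p _ => I3 p, ← integral_const_mul,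
      ← integral_add ((integrable_finsetSum _ fun p _ => I3 p).const_mul _) I2]
    refine integral_congr_ae (Eventually.of_forall fun x => ?_)
    show u x * hApply v x = -(1 / 2 : ℝ) * (∑ p, u x * pderiv p (pderiv p v) x) + luscherPotential x * (u x * v x)
    rw [hApply_def, laplacian_def, ← Finset.mul_sum]
    ring
  rw [eR, Finset.sum_neg_distrib]
  ring

/-- Green's identity, diagonal: `𝔮(u) = ∫ u · 𝔥u` for `u ∈ IsKacFn`. [cite: Agmon1982, (1.16)] -/
theorem energyForm_eq_integral_mul_hApply (hu : IsKacFn u) : energyForm u = ∫ x, u x * hApply u x := by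
  rw [← energyBil_self, energyBil_eq_integral_mul_hApply hu hu]

end Bilinear

/-! ### §2. Consequences for an AL1 eigenfamily -/

section Eigen

variable {m : ℕ} {f : Fin (m + 1) → ZM → ℝ} {u : ZM → ℝ}

/-- Against an eigenfunction the bilinear energy is `E_j ⟨u, f_j⟩` (`u ∈ IsKacFn`).
[cite: ReedSimonIV1978, Thm. XIII.64] -/
theorem energyBil_eigen (hf : IsEigenFamily m f) (hu : IsKacFn u) (j : Fin (m + 1)) :
    energyBil u (f j) = physLevel ((j : ℕ) + 1) * ∫ x, u x * f j x := by
  rw [energyBil_eq_integral_mul_hApply hu (isKacFn_of_isEigenFamily hf j), ← integral_const_mul]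
  refine integral_congr_ae (Eventually.of_forall fun x => ?_)
  show u x * hApply (f j) x = physLevel _ * (u x * f j x)
  rw [hf.2.2.2.1 j x]
  ring

/-- The same with the eigenfunction in the first slot. [cite: ReedSimonIV1978, Thm. XIII.64] -/
theorem energyBil_eigen_left (hf : IsEigenFamily m f) (hu : IsKacFn u) (j : Fin (m + 1)) :
    energyBil (f j) u = physLevel ((j : ℕ) + 1) * ∫ x, u x * f j x := by
  rw [energyBil_comm, energyBil_eigen hf hu j]

/-- Orthonormality in integral form for products `f_i · f_j`. [cite: ReedSimonIV1978, Thm. XIII.64] -/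
theorem IsEigenFamily.integral_mul (hf : IsEigenFamily m f) (i j : Fin (m + 1)) :
    ∫ x, f i x * f j x = if i = j then (1 : ℝ) else 0 := hf.2.2.1 i j

/-- `𝔮(u + Σ c_j f_j)` for `u ∈ IsKacFn`:
`= 𝔮(u) + 2 Σ_j c_j E_j ⟨u,f_j⟩ + Σ_j c_j² E_j`. [cite: ReedSimonIV1978, Thm. XIII.64] -/
theorem energyForm_add_span (hf : IsEigenFamily m f) (hu : IsKacFn u) (c : Fin (m + 1) → ℝ) :
    energyForm (u + fun x => ∑ j, c j * f j x) =
      energyForm u + 2 * (∑ j, c j * (physLevel ((j : ℕ) + 1) * ∫ x, u x * f j x))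
        + ∑ j, c j ^ 2 * physLevel ((j : ℕ) + 1) := by
  classical
  -- induct over the finite sum through a general statement on `Finset`s
  suffices h : ∀ s : Finset (Fin (m + 1)), energyForm (u + fun x => ∑ j ∈ s, c j * f j x) =
      energyForm u + 2 * (∑ j ∈ s, c j * (physLevel ((j : ℕ) + 1) * ∫ x, u x * f j x))
        + ∑ j ∈ s, c j ^ 2 * physLevel ((j : ℕ) + 1) from h Finset.univ
  intro s
  induction s using Finset.induction_on with
  | empty =>
    have e : (u + fun x : ZM => ∑ j ∈ (∅ : Finset (Fin (m + 1))), c j * f j x) = u := by funext x; simp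
    rw [e]; simp
  | insert a s ha ih =>
    have hS : IsKacFn (fun x => ∑ j ∈ s, c j * f j x) := isKacFn_sum_smul s f (isKacFn_of_isEigenFamily hf) c
    have huS : IsKacFn (u + fun x => ∑ j ∈ s, c j * f j x) := hu.add hS
    have hfa : IsKacFn (c a • f a) := (isKacFn_of_isEigenFamily hf a).smul (c a)
    have e : (u + fun x => ∑ j ∈ insert a s, c j * f j x) = (u + fun x => ∑ j ∈ s, c j * f j x) + c a • f a := by
      funext x; simp [Finset.sum_insert ha]; ring
    rw [e, energyForm_add huS hfa, ih, energyForm_smul' (isKacFn_of_isEigenFamily hf a),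
      ← energyBil_self (f a), energyBil_eigen hf (isKacFn_of_isEigenFamily hf a) a,
      energyBil_comm, energyBil_smul_left, energyBil_eigen_left hf huS a]
    -- `⟨u + S, f_a⟩ = ⟨u, f_a⟩ + Σ_{j∈s} c_j δ_{ja} = ⟨u, f_a⟩` since `a ∉ s`
    have hsplit : ∫ x, (u + fun x => ∑ j ∈ s, c j * f j x) x * f a x = ∫ x, u x * f a x := by
      have I0 : Integrable fun x => u x * f a x := hu.integrable_mul (isKacFn_of_isEigenFamily hf a)
      have Ij : ∀ j, Integrable fun x => c j * (f j x * f a x) := fun j =>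
        ((isKacFn_of_isEigenFamily hf j).integrable_mul (isKacFn_of_isEigenFamily hf a)).const_mul _
      have e1 : ∫ x, (u + fun x => ∑ j ∈ s, c j * f j x) x * f a x =
          ∫ x, (u x * f a x + ∑ j ∈ s, c j * (f j x * f a x)) :=
        integral_congr_ae (Eventually.of_forall fun x => by
          simp only [Pi.add_apply, add_mul, Finset.sum_mul]; congr 1
          exact Finset.sum_congr rfl fun j _ => by ring)
      rw [e1, integral_add I0 (integrable_finsetSum _ fun j _ => Ij j), integral_finsetSum _ fun j _ => Ij j]
      have hz : ∑ j ∈ s, ∫ x, c j * (f j x * f a x) = 0 := by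
        refine Finset.sum_eq_zero fun j hj => ?_
        rw [integral_const_mul, hf.integral_mul j a, if_neg (show j ≠ a from fun h => ha (h ▸ hj)), mul_zero]
      rw [hz, add_zero]
    rw [hsplit, hf.integral_mul a a, if_pos rfl, Finset.sum_insert ha, Finset.sum_insert ha]
    ring

/-- **Energy of the span**: `𝔮(Σ c_j f_j) = Σ c_j² E_j`. [cite: ReedSimonIV1978, Thm. XIII.64] -/
theorem energyForm_span (hf : IsEigenFamily m f) (c : Fin (m + 1) → ℝ) :
    energyForm (fun x => ∑ j, c j * f j x) = ∑ j, c j ^ 2 * physLevel ((j : ℕ) + 1) := by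
  have h := energyForm_add_span hf isKacFn_zero c
  simp only [zero_add, Pi.zero_apply, zero_mul, integral_zero, mul_zero, Finset.sum_const_zero] at h
  have e0 : energyForm (0 : ZM → ℝ) = 0 := by
    simp [energyForm, gradient]
  rw [e0] at h
  simpa using h

/-- **Energy of a member plus an orthogonal span piece**: if `u ⊥ f_j` for all `j` then
`𝔮(u + Σ c_j f_j) = 𝔮(u) + Σ c_j² E_j`. [cite: ReedSimonIV1978, Thm. XIII.64] -/
theorem energyForm_add_span_of_orthogonal (hf : IsEigenFamily m f) (hu : IsKacFn u) (c : Fin (m + 1) → ℝ)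
    (horth : ∀ j, ∫ x, u x * f j x = 0) :
    energyForm (u + fun x => ∑ j, c j * f j x) = energyForm u + ∑ j, c j ^ 2 * physLevel ((j : ℕ) + 1) := by
  rw [energyForm_add_span hf hu c]
  simp [horth]

end Eigen

end Summit.QuantumFields.YangMills.Theorems.FemtoTransferGap

end
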